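import Summits.BirchSwinnertonDyer.BirchSwinnertonDyer.Theorems.ErratumRoadFiveNonSurjCornerKolyJWalkOrderedBaseCeb
import Summits.BirchSwinnertonDyer.BirchSwinnertonDyer.Theorems.ErratumRoadFiveNonSurjCornerKolyJWalkTildeSignIrr
import Summits.BirchSwinnertonDyer.BirchSwinnertonDyer.Theorems.ErratumRoadFiveNonSurjCornerKolyJProp44OfFrobeniusCongruence
import Summits.BirchSwinnertonDyer.BirchSwinnertonDyer.Theorems.ErratumRoadFiveNonSurjCornerKolyJWalkCebotarev
import Summits.BirchSwinnertonDyer.BirchSwinnertonDyer.Theorems.ErratumRoadFiveNonSurjCornerKolyJLevelOneSupply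
import Summits.BirchSwinnertonDyer.BirchSwinnertonDyer.Theorems.ErratumRoadFiveNonSurjCornerMinusOneAtFive
import Summits.BirchSwinnertonDyer.BirchSwinnertonDyer.Theorems.ClassRecordThreeEulerHalvesAtThreeWalkSupplyTrivia
import Summits.BirchSwinnertonDyer.BirchSwinnertonDyer.Theorems.ClassRecordThreeEulerHalvesAtThreeWalkFinite
import Summits.BirchSwinnertonDyer.BirchSwinnertonDyer.Theorems.Rank1ResidualJetCoreVertexBridge
import Summits.BirchSwinnertonDyer.Rank1Residual.JET.GrossProp53Kolyvagin
import HarnessLib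

/-!
# Route `ErratumRoadFive` (rung K2), crux child `NonSurjCornerKolyJ` (item stmt-BirchSwinnertonDyer-19947), registered stub
# `stub_kolyJ_max`: its WALK input `hlev` ⟸ {Gross Prop. 3.7 (2) BY NAME; `−1 ∈ ρ̄_{E,7}(Γ_ℚ)` at `p = 7`; the per-frame
# SELMER supply in tam3's shape} — the corner twin of tam3-p1's `jetchevMaxHLAtThree_of_facts_of_selmerSupply`
# (cell `bsd-stepL`, seat `bsd-stepL-corner-p1` g11; `--supports stmt-BirchSwinnertonDyer-19947`)

WHY. Every display of `stub_kolyJ_max` (reading of record p522786; v3 `…SwapKappaDisplay`) takes the hypothesis `hlev` =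
the conclusion of the Jetchev walk at the corner frame, per level `k` (`ord_p c_v ≤ m(c)`). At `p = 3` under
surjectivity tam3-p1 derives the walk conclusion from SEVEN∕SIX named print facts plus a per-frame SELMER supply
(`…WalkSupplyAtThreeSelmer`, then discharges the supply from Poitou–Tate + Gross 1991 §6, `…DisplayPrint`). The
image hypothesis enters tam3's derivation in four places only: McCallum Prop. 4.4 (`h44`, tower-keyed typed fact →
`h47`), admissibility of `E(K[m])` (`hordκ`, `hκt`, `h49`) and Čebotarev (Lemma 6.1). On the corner all four are now
kernel: Prop. 4.4 «in particular» for `E[p]` irreducible modulo Gross Prop. 3.7 (2) BY NAME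
(`Prop44.exists_data_h47Base_of_frobeniusCongruence_of_irr`, this seat g9–g11), the (irr) admissibility twins
(`hordκ_of_admissibleData_of_irreducible` g7, `hκt_∕h49_of_selmerMembership_of_irreducible` g11), and the corner
Čebotarev (`exists_kolyvaginPrime_addOrderOf_localization_eq_shift_of_irr_of_neg` g7, with `−1 ∈ ρ̄(Γ_ℚ)` automatic
at `p = 5`, `GaloisImage.exists_smul_eq_neg_five_of_irr` g8) fed to the image-agnostic walk
`tamagawaExponent_le_m_of_orderedFamiliesBase_of_chebotarev` (g11). Gross Prop. 5.3 at the admissible conductors is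
bsd-jet's THEOREM `JET.exists_mem_ringClassGal_isOfFinAddOrder_conj_sub_smul`; the finiteness of `ord_p P_s` at `s = 1` is
needed only when the base conductor is `1`, where it is the walk's own premise (no `L(E^{d_K},1) ≠ 0` on a corner frame).
WHAT. `hlev_of_frobeniusCongruence_of_selmerSupply : h37 → hneg7 → hsupply → ‹hlev of the corner displays VERBATIM›`,
`hsupply` = tam3's per-frame Selmer supply shape with the corner frame binders and `3 ↦ p` (structures `𝒯 𝒮 Qcar C'`,
`hS`, `hQcar`, `hdisj`, `hPT`, root-class Selmer membership `hselmer`, `hC`, `hdual_q`, `hsel0`, `hdual_ℓ`).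
HONEST FRAMING: one CONDITIONAL theorem (named fact `h37`; `hneg7` genuine at `p = 7`; the supply is a hypothesis
nothing in the tree discharges on the corner yet — tam3's discharge `selmerSupplyAtThree_of_poitouTate_Gross1991` is
Surj-keyed); no definition ∕ fact ∕ sorry; no stub closes; nothing about any curve; BSD is not advanced; T7.
References (locators only): [cite: Jetchev2008, Thm. 1.4 (p. 812), §3–§6, Proof of Thm. 1.4 (pp. 822–825)]
[cite: McCallumLMS1991, §3 Cor. 3.2, §4 Prop. 4.4] [cite: GrossLMS1991, Prop. 3.7 (2), §5 Prop. 5.3, 5.4]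
[cite: Nekovar2007, Prop. 4.13 (ii)] [cite: WZhang2014, Notations (xii)].
-/

set_option autoImplicit false

noncomputable section

open scoped Classical NumberField

namespace Summit.BirchSwinnertonDyer.Rank1Residual.X11b.Three.Koly

open WeierstrassCurve IsDedekindDomain NumberField Field Literature.NumberTheory.EllipticCurves
  Literature.NumberTheory.EllipticCurves.ModularForms Literature.NumberTheory.EllipticCurves.Jetchev2008
  Literature.NumberTheory.EllipticCurves.KolyvaginCocycle
  Literature.NumberTheory.EllipticCurves.Rank1Residual Literature.NumberTheory.GaloisRepresentations
  Literature.NumberTheory.GaloisRepresentations.DiscreteGaloisModule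
  Literature.NumberTheory.GaloisCohomology
  Summit.BirchSwinnertonDyer.Rank1Residual Summit.BirchSwinnertonDyer.Rank1Residual.X11b
  Summit.BirchSwinnertonDyer.Rank1Residual.JET Summit.BirchSwinnertonDyer.BirchSwinnertonDyer.Theorems

/-- **The corner's `hlev` ⟸ {Gross Prop. 3.7 (2) BY NAME; `−1 ∈ ρ̄_{E,7}(Γ_ℚ)` at `p = 7`; the per-frame Selmer supply}**
— tam3's `jetchevMaxHLAtThree_of_facts_of_selmerSupply` ported to the (T4′) corner frame: `h44 ↦ h37` (kernel Prop. 4.4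
on the irreducible cell), admissibility ↦ the (irr) twins, Čebotarev ↦ the corner Čebotarev; see the module docstring.
[cite: Jetchev2008, Thm. 1.4 (p. 812), Proof of Thm. 1.4 (p. 825)] [cite: McCallumLMS1991, §4 Prop. 4.4, §3 Cor. 3.2]
[cite: GrossLMS1991, Prop. 3.7 (2), Prop. 5.3] -/
theorem hlev_of_frobeniusCongruence_of_selmerSupply
    (h37 : GrossLMS1991.prop37_2_frobeniusCongruence)
    (hneg7 : ∀ (W : WeierstrassCurve ℚ) [W.IsElliptic] [W.IsGloballyMinimal] [NeZero (W.conductorNorm ℤ)]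
      (p : ℕ) [Fact p.Prime], ClassX11b W p → ¬ Surj W p → p = 7 →
      ∃ γ : Field.absoluteGaloisGroup ℚ, ∀ P : geomTorsion W p, γ • P = -P)
    (hsupply : ∀ (W : WeierstrassCurve ℚ) [W.IsElliptic] [W.IsGloballyMinimal] [NeZero (W.conductorNorm ℤ)]
      (p : ℕ) [Fact p.Prime] (K : Type) [Field K] [NumberField K]
      (Dt : ModularParametrizationData W (W.conductorNorm ℤ)) (β : ℤ) (ι : K →+* ℂ),
      p ∣ W.tamagawaProduct →
      ClassX11b W p → ¬ Surj W p → (p = 5 ∨ p = 7) → p ∣ padicValInt p W.minimalDiscriminantInt →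
      ¬ Ram W p → IsImaginaryQuadratic K → 4 < (NumberField.discr K).natAbs →
      SatisfiesHeegnerHypothesis (W.conductorNorm ℤ) K → SatisfiesHeegnerHypothesis p K →
      (4 * (W.conductorNorm ℤ : ℤ)) ∣ β ^ 2 - NumberField.discr K → ¬ (p : ℤ) ∣ Dt.c →
      ∀ (τ : K ≃ₐ[ℚ] K), τ ≠ 1 → ∀ (v : HeightOneSpectrum (𝓞 ℚ)) (k : ℕ), 1 ≤ k →
        padicValNat p (W.tamagawaNumberAt v) ≤ k →
      ∀ (n : ℕ) (d : KolyvaginHeegnerData Dt β ι n) (hn : Squarefree n ∧ ∀ q ∈ n.primeFactors,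
        Zhang2014.IsKolyvaginPrime (W.conductorNorm ℤ) W K p q ∧ k ≤ Zhang2014.kolyvaginIndex W p q),
      ∀ (D : ∀ s : {m : ℕ // Squarefree m ∧ ∀ q ∈ m.primeFactors,
        Zhang2014.IsKolyvaginPrime (W.conductorNorm ℤ) W K p q ∧ k ≤ Zhang2014.kolyvaginIndex W p q},
          KolyvaginHeegnerData Dt β ι s.1), D ⟨n, hn⟩ = d →
      ∀ (ε : ℤ), (ε = 1 ∨ ε = -1) → ∀ (eb : ℕ → Bool),
        (∀ (m ℓ : ℕ), ℓ.Prime → ¬ ℓ ∣ m → eb (m * ℓ) = !eb m) →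
        (∀ m, (if eb m then (1 : ℤ) else -1) = ε * (-1) ^ m.primeFactors.card) →
      ∃ (𝒯 𝒮 : SelmerStructure ((W.baseChange K).torsionGaloisModule ((p ^ k : ℕ) : ℤ)))
        (Qcar : Finset (HeightOneSpectrum (𝓞 K)))
        (C' : ℕ → AddSubgroup (galoisCohomology ((W.baseChange K).torsionGaloisModule ((p ^ k : ℕ) : ℤ)) 1)),
        (∀ v, 𝒮 v ≤ (W.baseChange K).kummerSelmerStructure ((p ^ k : ℕ) : ℤ) v) ∧
        (∀ v ∈ Qcar, ((W.conductorNorm ℤ : ℕ) : 𝓞 K) ∈ v.asIdeal) ∧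
        (∀ (ℓ : ℕ), Zhang2014.IsKolyvaginPrime (W.conductorNorm ℤ) W K p ℓ →
      k ≤ Zhang2014.kolyvaginIndex W p ℓ → ¬ ℓ ∣ n → ∀ v : HeightOneSpectrum (𝓞 K), (ℓ : 𝓞 K) ∈ v.asIdeal →
      Disjoint ((W.baseChange K).kummerSelmerStructure ((p ^ k : ℕ) : ℤ) (Sum.inr v)) (𝒯 (Sum.inr v))) ∧
        (∀ (s : {m : ℕ // Squarefree m ∧ ∀ q ∈ m.primeFactors,
        Zhang2014.IsKolyvaginPrime (W.conductorNorm ℤ) W K p q ∧ k ≤ Zhang2014.kolyvaginIndex W p q})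
      (ℓ : ℕ), Zhang2014.IsKolyvaginPrime (W.conductorNorm ℤ) W K p ℓ →
      k ≤ Zhang2014.kolyvaginIndex W p ℓ → ¬ ℓ ∣ s.1 → (∀ q ∈ s.1.primeFactors, q < ℓ) → n ∣ s.1 →
      ∀ v : HeightOneSpectrum (𝓞 K), (ℓ : 𝓞 K) ∈ v.asIdeal → ∀ b : Bool,
      Nat.card ((signPart W K τ ((p ^ k : ℕ) : ℤ) (if b then 1 else -1)
          ((selmerF W ((p ^ k : ℕ) : ℤ) 𝒯 (placesDividing K s.1)).relaxedAt {v}).selmerGroup).map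
        (galoisCohomology.localization ((W.baseChange K).torsionGaloisModule ((p ^ k : ℕ) : ℤ))
          (Sum.inr v) 1)) = p ^ k) ∧
        (∀ s (u : ℕ) (Q : (W.baseChange (ringClassField K ι s.1)).toAffine.Point)
      (hAk : IsAdmissible (absoluteGaloisGroup K) (D s).pointsSubgroup ((p ^ k : ℕ) : ℤ))
      (hQ : (D s).toGeomPoints Q ∈ invPoints (absoluteGaloisGroup K) (D s).pointsSubgroup ((p ^ k : ℕ) : ℤ)),
      ((p ^ u : ℕ) : ℤ) • Q = (D s).derivedPoint →
      (¬ ∃ Q' : (W.baseChange (ringClassField K ι s.1)).toAffine.Point,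
        ((p ^ (u + 1) : ℕ) : ℤ) • Q' = (D s).derivedPoint) →
      ((u + k : ℕ) : ℕ∞) ≤ Zhang2014.levelIndex W p s.1 →
      (kolyvaginClass (W.baseChange K) ((p ^ k : ℕ) : ℤ)
        ((W.baseChange K).zsmul_geomPoints_surjective_of_charZero
          (by exact_mod_cast pow_ne_zero k (Fact.out : p.Prime).ne_zero)) hAk ((D s).toGeomPoints Q) hQ :
          galoisCohomology ((W.baseChange K).torsionGaloisModule ((p ^ k : ℕ) : ℤ)) 1) ∈
        (selmerF W ((p ^ k : ℕ) : ℤ) 𝒯 (placesDividing K s.1)).selmerGroup) ∧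
        (∀ m, C' m ≤ signPart W K τ ((p ^ k : ℕ) : ℤ) (if !eb m then 1 else -1) ⊤) ∧
        (∀ s : {m : ℕ // Squarefree m ∧ ∀ q ∈ m.primeFactors,
        Zhang2014.IsKolyvaginPrime (W.conductorNorm ℤ) W K p q ∧ k ≤ Zhang2014.kolyvaginIndex W p q},
      n ∣ s.1 → ∃ (Qg Qg' : Type) (_ : AddCommGroup Qg) (_ : AddCommGroup Qg') (_ : Finite Qg')
        (locq : signPart W K τ ((p ^ k : ℕ) : ℤ) (if !eb s.1 then 1 else -1)
            (selmerF W ((p ^ k : ℕ) : ℤ) 𝒯 (placesDividing K s.1)).selmerGroup →+ Qg)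
        (locq' : C' s.1 →+ Qg'),
        (∀ x : C' s.1, locq' x = 0 ↔
          (x : galoisCohomology ((W.baseChange K).torsionGaloisModule ((p ^ k : ℕ) : ℤ)) 1) ∈
            signPart W K τ ((p ^ k : ℕ) : ℤ) (if !eb s.1 then 1 else -1)
              (selmerF W ((p ^ k : ℕ) : ℤ) 𝒯 (placesDividing K s.1)).selmerGroup) ∧
        Nat.card locq.range * Nat.card locq'.range = Nat.card Qg' ∧ IsAddCyclic Qg' ∧
        Nat.card Qg' = p ^ padicValNat p (W.tamagawaNumberAt v)) ∧
        (∀ (s s' : {m : ℕ // Squarefree m ∧ ∀ q ∈ m.primeFactors,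
        Zhang2014.IsKolyvaginPrime (W.conductorNorm ℤ) W K p q ∧ k ≤ Zhang2014.kolyvaginIndex W p q})
      (ℓ : ℕ), ℓ.Prime → ¬ ℓ ∣ s.1 → s'.1 = s.1 * ℓ → (∀ q ∈ s.1.primeFactors, q < ℓ) → n ∣ s.1 →
      ∀ v : HeightOneSpectrum (𝓞 K), (ℓ : 𝓞 K) ∈ v.asIdeal →
      ((D s').kolyvaginClass (Fact.out : p.Prime) k :
          galoisCohomology ((W.baseChange K).torsionGaloisModule ((p ^ k : ℕ) : ℤ)) 1) ∈
        (((selmerF0 W ((p ^ k : ℕ) : ℤ) 𝒯 𝒮 (placesDividing K s.1) Qcar).relaxedAt {v}).selmerGroup)) ∧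
        (∀ (s : {m : ℕ // Squarefree m ∧ ∀ q ∈ m.primeFactors,
        Zhang2014.IsKolyvaginPrime (W.conductorNorm ℤ) W K p q ∧ k ≤ Zhang2014.kolyvaginIndex W p q})
      (ℓ : ℕ), Zhang2014.IsKolyvaginPrime (W.conductorNorm ℤ) W K p ℓ →
      k ≤ Zhang2014.kolyvaginIndex W p ℓ → ¬ ℓ ∣ s.1 → (∀ q ∈ s.1.primeFactors, q < ℓ) → n ∣ s.1 →
      ∀ v : HeightOneSpectrum (𝓞 K), (ℓ : 𝓞 K) ∈ v.asIdeal →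
      ∃ (Sg : Type) (_ : AddCommGroup Sg)
        (sing : signPart W K τ ((p ^ k : ℕ) : ℤ) (if !eb s.1 then 1 else -1)
            (((selmerF0 W ((p ^ k : ℕ) : ℤ) 𝒯 𝒮 (placesDividing K s.1) Qcar).relaxedAt {v}).selmerGroup)
          →+ Sg),
        (∀ x, sing x = 0 ↔
          (x : galoisCohomology ((W.baseChange K).torsionGaloisModule ((p ^ k : ℕ) : ℤ)) 1) ∈
            signPart W K τ ((p ^ k : ℕ) : ℤ) (if !eb s.1 then 1 else -1)
              ((selmerF0 W ((p ^ k : ℕ) : ℤ) 𝒯 𝒮 (placesDividing K s.1) Qcar).selmerGroup)) ∧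
        Nat.card sing.range *
          Nat.card ((C' s.1).map (galoisCohomology.localization
            ((W.baseChange K).torsionGaloisModule ((p ^ k : ℕ) : ℤ)) (Sum.inr v) 1)) = p ^ k)) :
    ∀ (W : WeierstrassCurve ℚ) [W.IsElliptic] [W.IsGloballyMinimal] [NeZero (W.conductorNorm ℤ)]
      (p : ℕ) [Fact p.Prime] (K : Type) [Field K] [NumberField K]
      (Dt : ModularParametrizationData W (W.conductorNorm ℤ)) (β : ℤ) (ι : K →+* ℂ),
      p ∣ W.tamagawaProduct →
      ClassX11b W p → ¬ Surj W p → (p = 5 ∨ p = 7) → p ∣ padicValInt p W.minimalDiscriminantInt →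
      ¬ Ram W p → IsImaginaryQuadratic K → 4 < (NumberField.discr K).natAbs →
      SatisfiesHeegnerHypothesis (W.conductorNorm ℤ) K → SatisfiesHeegnerHypothesis p K →
      (4 * (W.conductorNorm ℤ : ℤ)) ∣ β ^ 2 - NumberField.discr K → ¬ (p : ℤ) ∣ Dt.c →
      ∀ (v : HeightOneSpectrum (𝓞 ℚ)) (k n : ℕ) (d : KolyvaginHeegnerData Dt β ι n), Squarefree n →
        (∀ ℓ ∈ n.primeFactors, Zhang2014.IsKolyvaginPrime (W.conductorNorm ℤ) W K p ℓ) →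
        (if divOrd d p < Zhang2014.levelIndex W p n then divOrd d p else (⊤ : ℕ∞)) < (k : ℕ∞) →
        padicValNat p (W.tamagawaNumberAt v) ≤ k →
        (k : ℕ∞) + (if divOrd d p < Zhang2014.levelIndex W p n then divOrd d p else ⊤) ≤
          Zhang2014.levelIndex W p n →
        (padicValNat p (W.tamagawaNumberAt v) : ℕ∞) ≤
          (if divOrd d p < Zhang2014.levelIndex W p n then divOrd d p else ⊤) := by
  intro W _ _ _ p _ K _ _ Dt β ι htam hX hns h57 hvΔ hnr hK' hd hHN hHp hβ hc v k n d hsq hkol h1 h2 h3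
  have hp : p.Prime := Fact.out
  have hp2 : p ≠ 2 := hX.2.1
  have hp3 : p ≠ 3 := by rcases h57 with rfl | rfl <;> decide
  have hirr : W.HasIrreducibleModPGaloisRep p := hX.2.2.2
  -- `k ≥ 1` and the admissibility of `n` at level `k`
  have hk : 1 ≤ k := by
    rcases Nat.eq_zero_or_pos k with rfl | hk
    · exact absurd h1 (by simp)
    · exact hk
  have hkM : (k : ℕ∞) ≤ Zhang2014.levelIndex W p n := le_trans le_self_add h3
  have hn : Squarefree n ∧ ∀ q ∈ n.primeFactors,
      Zhang2014.IsKolyvaginPrime (W.conductorNorm ℤ) W K p q ∧ k ≤ Zhang2014.kolyvaginIndex W p q :=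
    ⟨hsq, fun q hq ↦ ⟨hkol q hq, Zhang2014.natCast_le_levelIndex_iff.mp hkM q hq⟩⟩
  -- frame facts: complex conjugation, `(N, d_K) = 1`, `d_K < -4`, the disjointness prime, `−1 ∈ ρ̄(Γ_ℚ)`
  obtain ⟨τ, hτ⟩ := exists_algEquiv_ne_one_of_isImaginaryQuadratic K hK'
  have hND : IsCoprime ((W.conductorNorm ℤ : ℕ) : ℤ) (NumberField.discr K) :=
    KolyvaginAssembly.isCoprime_discr_of_satisfiesHeegnerHypothesis hK' hHN
  have hDneg : NumberField.discr K < 0 := (isImaginaryQuadratic_iff_discr_neg.1 hK').2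
  have hD : NumberField.discr K < -4 := by omega
  obtain ⟨q, hq, hqd, hqN, hqp⟩ := exists_prime_dvd_discr_of_heegner hK'.1 hd hHN hHp
  have hneg : ∃ γ : Field.absoluteGaloisGroup ℚ, ∀ P : geomTorsion W p, γ • P = -P := by
    rcases h57 with rfl | rfl
    · exact GaloisImage.exists_smul_eq_neg_five_of_irr W hirr
    · exact hneg7 W 7 hX hns rfl
  -- Gross's one system of choices extending `d`, and Prop. 4.7 for it — KERNEL modulo Gross 3.7 (2) BY NAME
  obtain ⟨D, hDd, h47⟩ := Prop44.exists_data_h47Base_of_frobeniusCongruence_of_irr h37 W hK' hD hHN hp2 hp3 hHp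
    hirr Dt β ι hk hn d
  -- the sign `ε := −w(E)`, a sign function for it, and Gross Prop. 5.3 for the data (bsd-jet's THEOREM)
  have hε : (-W.rootNumber : ℤ) = 1 ∨ (-W.rootNumber : ℤ) = -1 := by
    rcases W.rootNumber_eq_one_or with h | h <;> simp [h]
  obtain ⟨eb, heb, hebε⟩ := Walk.exists_signFunction (-W.rootNumber) hε
  have h53D : ∀ (s s' : {m : ℕ // Squarefree m ∧ ∀ q ∈ m.primeFactors,
        Zhang2014.IsKolyvaginPrime (W.conductorNorm ℤ) W K p q ∧ k ≤ Zhang2014.kolyvaginIndex W p q})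
      (_ : s'.1 ∣ s.1) (τm : ringClassField K ι s'.1 ≃ₐ[ℚ] ringClassField K ι s'.1),
      (∀ x : ringClassField K ι s'.1, ((τm x : ringClassField K ι s'.1) : ℂ) = starRingEnd ℂ x) →
      ∃ σ' ∈ ringClassGal ι s'.1, IsOfFinAddOrder
        (pointGalHom W (ringClassField K ι s'.1) τm (D s').y -
          (-W.rootNumber) • pointGalHom W (ringClassField K ι s'.1) σ' (D s').y) := by
    intro s s' _ τm hτm
    obtain ⟨hm0, hmN⟩ := ne_zero_and_coprime_of_isKolyvaginPrime (K := K) s'.2.1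
      (fun q hq ↦ (s'.2.2 q hq).1)
    exact exists_mem_ringClassGal_isOfFinAddOrder_conj_sub_smul W hK' hHN Dt ι hm0 hmN (D s') τm hτm
  -- the supply at this frame, for these data and signs
  obtain ⟨𝒯, 𝒮, Qcar, C', hS, hQcar, hdisj, hPT, hselmer, hC, hdual_q, hsel0, hdual_ℓ⟩ :=
    hsupply W p K Dt β ι htam hX hns h57 hvΔ hnr hK' hd hHN hHp hβ hc τ hτ v k hk h2 n d hn D hDd (-W.rootNumber)
      hε eb heb hebε
  have h49 := h49_of_selmerMembership_of_irreducible W hK' hND hD hp2 hirr hHp Dt β ι hτ hk 𝒯 𝒮 Qcar D eb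
    (-W.rootNumber) hebε h53D n hsel0
  have hordκ := hordκ_of_admissibleData_of_irreducible W hK' hND hD hp2 hirr hHp Dt β ι k D
  -- finiteness of `ord_p P_s` at `M(s) = ∞` is needed only at the base conductor, where it is `h1`
  have hdivfin : ∀ s : {m : ℕ // Squarefree m ∧ ∀ q ∈ m.primeFactors,
      Zhang2014.IsKolyvaginPrime (W.conductorNorm ℤ) W K p q ∧ k ≤ Zhang2014.kolyvaginIndex W p q},
      n ∣ s.1 → Zhang2014.levelIndex W p s.1 = ⊤ → divOrd (D s) p ≠ ⊤ := by
    intro s hns hM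
    -- `M(s) = ∞` forces `s = 1`, hence `n = 1` and `D s = d`
    have hs1 : s.1 = 1 := by
      by_contra h
      have hne : s.1.primeFactors.Nonempty := Nat.nonempty_primeFactors.mpr (by
        have := s.2.1.ne_zero; omega)
      obtain ⟨r, hr⟩ := hne
      have hle := (Zhang2014.natCast_le_levelIndex_iff (W := W) (p := p)
        (M := Zhang2014.kolyvaginIndex W p r + 1) (n := s.1)).mp (by rw [hM]; exact le_top) r hr
      omega
    have hn1 : n = 1 := Nat.eq_one_of_dvd_one (hs1 ▸ hns)
    subst hn1
    have hsd : s = ⟨1, hn⟩ := Subtype.ext hs1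
    subst hsd
    rw [hDd]
    intro htop
    rw [htop] at h1
    simp at h1
  have hfin := JET.Walk.hfin_of_kummer (K := K) W hp k 𝒯
  have hκt := hκt_of_selmerMembership_of_irreducible W hK' hND hD hp2 hirr hHp Dt β ι hτ hk 𝒯 D eb
    (-W.rootNumber) hebε h53D n hdivfin hselmer
  have key := tamagawaExponent_le_m_of_orderedFamiliesBase_of_chebotarev W K p Dt β ι τ k
    (padicValNat p (W.tamagawaNumberAt v)) h2
    (fun j e he x y hx hy hy0 b ↦ exists_kolyvaginPrime_addOrderOf_localization_eq_shift_of_irr_of_neg W hK'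
      hp2 hirr hneg hq hqd hqN hqp τ hτ hk j he x y hx hy hy0 b)
    𝒯 𝒮 hS Qcar hQcar D eb heb n hn ?_ ?_ hdisj hfin hPT hκt hordκ h47 C' hC hdual_q h49 hdual_ℓ
  · rw [hDd] at key
    exact key
  · rw [hDd]; exact h1
  · rw [hDd]; exact h3

end Summit.BirchSwinnertonDyer.Rank1Residual.X11b.Three.Koly

end
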